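import Mathlib.Analysis.Convex.Integral
import Mathlib.Analysis.Convex.SpecificFunctions.Basic
import Mathlib.MeasureTheory.Integral.Average
import Mathlib.MeasureTheory.Measure.Lebesgue.VolumeOfBalls
import Literature.Barriers.AtomisticToContinuum.ShockFormationIdentities
import HarnessLib

/-!
# Sideris 1985, Theorem 1 — the estimates (2.2 a–c)

Support file 6 for the discharge of
`Literature.Barriers.AtomisticToContinuum.ShockFormationBarrier` (Sideris, Comm. Math. Phys.
101 (1985), Thm. 1). For a `C¹` solution `(ρ, u, S)` of (1.1 a–d) on `[0, ∞) × ℝ³` at rest beyond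
the front `‖x‖ = R + σ t` (Sideris' Proposition), with `B(t) = closedBall 0 (R + σ t)`:

* (2.2a) `∫ (p - p̄) ≥ 0` (`integral_pressure_sub_nonneg`): by (1.1d) `p = A (ρ e^{S/γ})^γ`,
  Jensen's inequality for `y ↦ y^γ` (`γ > 1`) on `B(t)`, (2.1b) and (1.5b) `η(0) ≥ 0`,
  `∫_{B(t)} p ≥ A (vol B)^{1-γ} (∫_{B(t)} ρ e^{S/γ})^γ ≥ p̄ vol B(t)`;
* (2.2c) `∫_{B(t)} ρ = ∫_{B(t)} ρ⁰ ≤ vol B(t) · max ρ⁰` (`setIntegral_density_eq`, (2.1a));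
* (2.2b) `F(t)² ≤ ((R + σt)² ∫_{B(t)} ρ) · ∫ ρ ‖u‖²` (`sq_radialMomentum_le`, printed via the
  Schwarz inequality; here through the equivalent family of AM–GM bounds
  `2λ |F| ≤ λ² (R + σt)² ∫_B ρ + ∫ ρ‖u‖²`, `λ > 0`, which avoids `L²` bookkeeping);
* the volume of the ball, `vol B(t) = (4π/3)(R + σt)³` (`volume_real_closedBall_fin_three`).

## Mathlib search

Jensen `ConvexOn.map_set_average_le` with `convexOn_rpow`, `setAverage_eq`, `setIntegral_const`,
`EuclideanSpace.volume_closedBall_fin_three`, `Real.mul_rpow`, `Real.exp_mul`. No definitions.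

## References

* T. C. Sideris, Comm. Math. Phys. 101 (1985) 475–485, §2 (2.2 a–c) p. 479.
-/

noncomputable section

open Set Function Filter MeasureTheory Metric
open scoped RealInnerProductSpace Topology

namespace Literature.Barriers.AtomisticToContinuum.PolytropicEuler

open Literature.Analysis.FluidPDE Literature.Analysis.FluidPDE.VectorCalculus

/-! ### The volume of a ball in `ℝ³` -/

/-- `vol (closedBall x r) = (4π/3) r³` in `ℝ³`, as a real number (`r ≥ 0`). [folklore] -/
theorem volume_real_closedBall_fin_three (x : E3) {r : ℝ} (hr : 0 ≤ r) :
    (volume : Measure E3).real (closedBall x r) = 4 * Real.pi / 3 * r ^ 3 := by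
  rw [measureReal_def, EuclideanSpace.volume_closedBall_fin_three, ENNReal.toReal_mul,
    ENNReal.toReal_pow, ENNReal.toReal_ofReal hr, ENNReal.toReal_ofReal (by positivity)]
  ring

section Estimates

variable {A γ R σ ρbar Sbar : ℝ} {ρ : ℝ → E3 → ℝ} {u : ℝ → E3 → E3} {S : ℝ → E3 → ℝ}

/-! ### (2.2a) the pressure integral is nonnegative (Jensen) -/

/-- `(ρ e^{S/γ})^γ = ρ^γ e^S` for `ρ ≥ 0`, `γ ≠ 0`: the polytropic pressure is `A` times the
`γ`-th power of the entropy-weighted density (1.1d). [cite: Sideris1985, (1.1d)] -/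
theorem rpow_mul_exp_div {r s γ : ℝ} (hr : 0 ≤ r) (hγ : γ ≠ 0) :
    (r * Real.exp (s / γ)) ^ γ = r ^ γ * Real.exp s := by
  rw [Real.mul_rpow hr (Real.exp_pos _).le, ← Real.exp_mul, div_mul_cancel₀ s hγ]

/-- **(2.2a)** `0 ≤ ∫ (p - p̄) dx` for `t ≥ 0`: with `φ = ρ e^{S/γ}` one has `p = A φ^γ` (1.1d), so by
Jensen's inequality on `B(t) = closedBall 0 (R + σt)` (`γ > 1`),
`∫_B p ≥ A vol(B)^{1-γ} (∫_B φ)^γ = A vol(B)^{1-γ} (η(t) + vol(B) ρ̄ e^{S̄/γ})^γ ≥ p̄ vol(B)` using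
(2.1b) `η(t) = η(0)` and (1.5b) `η(0) ≥ 0`; outside `B(t)` the integrand vanishes
(Sideris §2, display before (2.2a)). [cite: Sideris1985, §2 (2.2a)] -/
theorem integral_pressure_sub_nonneg (h : IsPolytropicC1Solution A γ (Ici 0) ρ u S) (hA : 0 < A)
    (hγ : 1 < γ) (hρbar : 0 < ρbar) (hR : 0 < R) (hσ : 0 ≤ σ)
    (hrest : ∀ t, 0 ≤ t → ∀ x : E3, R + σ * t ≤ ‖x‖ → ρ t x = ρbar ∧ u t x = 0 ∧ S t x = Sbar)
    (hη : 0 ≤ entropyMassExcess γ ρbar Sbar ρ S 0) {t : ℝ} (ht : 0 ≤ t) :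
    0 ≤ ∫ x, (polytropicPressure A γ (ρ t x) (S t x) - polytropicPressure A γ ρbar Sbar) := by
  have hγ0 : 0 < γ := zero_lt_one.trans hγ
  have ht' : t ∈ Ici (0 : ℝ) := ht
  -- the ball `B` and its volume `V`
  set r := R + σ * t with hr
  have hr0 : 0 < r := by rw [hr]; nlinarith
  set B : Set E3 := closedBall (0 : E3) r with hB
  set V : ℝ := (volume : Measure E3).real B with hV
  have hBmeas : MeasurableSet B := measurableSet_closedBall
  have hBc : IsCompact B := isCompact_closedBall _ _
  have hμB0 : (volume : Measure E3) B ≠ 0 := (measure_closedBall_pos volume _ hr0).ne'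
  have hμBtop : (volume : Measure E3) B ≠ ⊤ := measure_closedBall_lt_top.ne
  have hV0 : 0 < V := by
    rw [hV, measureReal_def]
    exact ENNReal.toReal_pos hμB0 hμBtop
  have hrestB : ∀ x ∉ B, ρ t x = ρbar ∧ u t x = 0 ∧ S t x = Sbar := fun x hx =>
    rest_of_notMem_closedBall (T := t) hσ hrest ht le_rfl hx
  -- the entropy-weighted density `φ` and the rest value `c₀`
  set φ : E3 → ℝ := fun x => ρ t x * Real.exp (S t x / γ) with hφ
  set c₀ : ℝ := ρbar * Real.exp (Sbar / γ) with hc₀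
  have hc₀0 : 0 < c₀ := mul_pos hρbar (Real.exp_pos _)
  have hρs : ContDiff ℝ 1 (ρ t) := contDiff_slice_of_contDiffOn h.contDiffOn_density ht'
  have hSs : ContDiff ℝ 1 (S t) := contDiff_slice_of_contDiffOn h.contDiffOn_entropy ht'
  have hφc : Continuous φ := hρs.continuous.mul (hSs.continuous.div_const γ).rexp
  have hφpos : ∀ x, 0 < φ x := fun x => mul_pos (h.density_pos t ht x) (Real.exp_pos _)
  have hφγ : ∀ x, φ x ^ γ = polytropicPressure A γ (ρ t x) (S t x) / A := by
    intro x
    rw [hφ, rpow_mul_exp_div (h.density_pos t ht x).le hγ0.ne', polytropicPressure]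
    field_simp
  -- Step 1: `∫_B φ = η(0) + c₀ V ≥ c₀ V`
  have hφint : IntegrableOn φ B := hφc.continuousOn.integrableOn_compact hBc
  have hIφ : ∫ x in B, φ x = entropyMassExcess γ ρbar Sbar ρ S 0 + c₀ * V := by
    have h1 : ∫ x in B, (φ x - c₀) = ∫ x, (φ x - c₀) :=
      setIntegral_eq_integral_of_forall_compl_eq_zero fun x hx => by
        simp only [hφ, hc₀, (hrestB x hx).1, (hrestB x hx).2.2, sub_self]
    have h2 : ∫ x in B, (φ x - c₀) = (∫ x in B, φ x) - c₀ * V := by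
      rw [integral_sub hφint (integrableOn_const hμBtop), setIntegral_const, smul_eq_mul, mul_comm]
    have h3 : ∫ x, (φ x - c₀) = entropyMassExcess γ ρbar Sbar ρ S t := rfl
    rw [h3, entropyMassExcess_eq h hγ0.ne' hσ hrest ht] at h1
    linarith
  have hIφ_ge : c₀ * V ≤ ∫ x in B, φ x := by rw [hIφ]; linarith
  -- Step 2: Jensen for `y ↦ y^γ` on `B`
  have hJ : (⨍ x in B, φ x) ^ γ ≤ ⨍ x in B, φ x ^ γ := by
    refine (convexOn_rpow hγ.le).map_set_average_le
      (Real.continuous_rpow_const hγ0.le).continuousOn isClosed_Ici hμB0 hμBtop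
      (Eventually.of_forall fun x => (hφpos x).le) hφint ?_
    exact ((hφc.rpow_const fun x => Or.inl (hφpos x).ne').continuousOn.integrableOn_compact hBc)
  rw [setAverage_eq, setAverage_eq, smul_eq_mul, smul_eq_mul] at hJ
  -- Step 3: `∫_B p ≥ V p̄`
  have hIp : V * polytropicPressure A γ ρbar Sbar ≤
      ∫ x in B, polytropicPressure A γ (ρ t x) (S t x) := by
    -- `∫_B φ^γ = (∫_B p) / A`
    have h1 : ∫ x in B, φ x ^ γ = (∫ x in B, polytropicPressure A γ (ρ t x) (S t x)) / A := by
      simp_rw [hφγ]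
      exact integral_div A _
    -- lower bound for the average of `φ`
    have havg : c₀ ≤ V⁻¹ * ∫ x in B, φ x := by
      rw [le_inv_mul_iff₀ hV0]
      linarith
    have hpow : c₀ ^ γ ≤ (V⁻¹ * ∫ x in B, φ x) ^ γ := Real.rpow_le_rpow hc₀0.le havg hγ0.le
    have hc₀γ : c₀ ^ γ = polytropicPressure A γ ρbar Sbar / A := by
      rw [hc₀, rpow_mul_exp_div hρbar.le hγ0.ne', polytropicPressure]
      field_simp
    -- combine
    have h2 : polytropicPressure A γ ρbar Sbar / A ≤
        V⁻¹ * ((∫ x in B, polytropicPressure A γ (ρ t x) (S t x)) / A) := by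
      rw [← hc₀γ, ← h1]
      exact hpow.trans hJ
    rw [le_inv_mul_iff₀ hV0, ← mul_div_assoc, div_le_div_iff_of_pos_right hA] at h2
    exact h2
  -- Step 4: `∫ (p - p̄) = ∫_B (p - p̄) = ∫_B p - V p̄ ≥ 0`
  have hPs : ContDiff ℝ 1 (fun y => polytropicPressure A γ (ρ t y) (S t y)) :=
    contDiff_slice_of_contDiffOn (w := fun s y => polytropicPressure A γ (ρ s y) (S s y))
      h.contDiffOn_pressure ht'
  have h1 : ∫ x in B, (polytropicPressure A γ (ρ t x) (S t x) - polytropicPressure A γ ρbar Sbar) =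
      ∫ x, (polytropicPressure A γ (ρ t x) (S t x) - polytropicPressure A γ ρbar Sbar) :=
    setIntegral_eq_integral_of_forall_compl_eq_zero fun x hx => by
      rw [(hrestB x hx).1, (hrestB x hx).2.2, sub_self]
  rw [← h1, integral_sub (hPs.continuous.continuousOn.integrableOn_compact hBc)
    (integrableOn_const hμBtop), setIntegral_const, smul_eq_mul]
  linarith

/-! ### (2.2c) the mass in the ball -/

/-- **(2.2c), first half**: `∫_{B(t)} ρ(t) = ∫_{B(t)} ρ(0)` for `B(t) = closedBall 0 (R + σt)`,
`t ≥ 0` (by (2.1a) `m(t) = m(0)` and `ρ - ρ̄ = 0` off `B(t) ⊇ B(0)`). [cite: Sideris1985, §2 (2.2c)] -/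
theorem setIntegral_density_eq (h : IsPolytropicC1Solution A γ (Ici 0) ρ u S) (hσ : 0 ≤ σ)
    (hrest : ∀ t, 0 ≤ t → ∀ x : E3, R + σ * t ≤ ‖x‖ → ρ t x = ρbar ∧ u t x = 0 ∧ S t x = Sbar)
    {t : ℝ} (ht : 0 ≤ t) :
    ∫ x in closedBall (0 : E3) (R + σ * t), ρ t x = ∫ x in closedBall (0 : E3) (R + σ * t), ρ 0 x := by
  set B : Set E3 := closedBall (0 : E3) (R + σ * t) with hB
  have hBc : IsCompact B := isCompact_closedBall _ _
  have hμBtop : (volume : Measure E3) B ≠ ⊤ := measure_closedBall_lt_top.ne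
  have hrestB : ∀ s, 0 ≤ s → s ≤ t → ∀ x ∉ B, ρ s x = ρbar := fun s hs hst x hx =>
    (rest_of_notMem_closedBall (T := t) hσ hrest hs hst hx).1
  have key : ∀ s, 0 ≤ s → s ≤ t → ∫ x in B, ρ s x = massExcess ρbar ρ s + ρbar *
      (volume : Measure E3).real B := by
    intro s hs hst
    have hρs : ContDiff ℝ 1 (ρ s) := contDiff_slice_of_contDiffOn h.contDiffOn_density hs
    have h1 : ∫ x in B, (ρ s x - ρbar) = ∫ x, (ρ s x - ρbar) :=
      setIntegral_eq_integral_of_forall_compl_eq_zero fun x hx => by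
        rw [hrestB s hs hst x hx, sub_self]
    have h2 : ∫ x in B, (ρ s x - ρbar) = (∫ x in B, ρ s x) - ρbar * (volume : Measure E3).real B := by
      rw [integral_sub (hρs.continuous.continuousOn.integrableOn_compact hBc)
        (integrableOn_const hμBtop), setIntegral_const, smul_eq_mul, mul_comm]
    have h3 : ∫ x, (ρ s x - ρbar) = massExcess ρbar ρ s := rfl
    linarith
  rw [key t ht le_rfl, key 0 le_rfl ht, massExcess_eq h hσ hrest ht]

/-- The initial density of a `C¹` solution with rest data beyond `‖x‖ = R` is bounded above (it is
continuous and eventually constant), so `⨆ x, ρ(0, x)` is a genuine supremum. [folklore] -/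
theorem bddAbove_range_density_zero (h : IsPolytropicC1Solution A γ (Ici 0) ρ u S)
    (hfar : ∀ x : E3, R ≤ ‖x‖ → ρ 0 x = ρbar ∧ u 0 x = 0 ∧ S 0 x = Sbar) :
    BddAbove (range (ρ 0)) := by
  have hρ0 : Continuous (ρ 0) :=
    (contDiff_slice_of_contDiffOn h.contDiffOn_density (mem_Ici.2 le_rfl)).continuous
  obtain ⟨C, hC⟩ := (isCompact_closedBall (0 : E3) R).exists_bound_of_continuousOn
    hρ0.continuousOn
  refine ⟨max C ρbar, ?_⟩
  rintro _ ⟨x, rfl⟩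
  by_cases hx : x ∈ closedBall (0 : E3) R
  · exact ((le_abs_self _).trans (by simpa [Real.norm_eq_abs] using hC x hx)).trans (le_max_left _ _)
  · rw [mem_closedBall, dist_zero_right, not_le] at hx
    rw [(hfar x hx.le).1]
    exact le_max_right _ _

/-- **(2.2c), second half**: `∫_{B(t)} ρ(0) ≤ vol B(t) · max ρ⁰`. [cite: Sideris1985, §2 (2.2c)] -/
theorem setIntegral_density_zero_le (h : IsPolytropicC1Solution A γ (Ici 0) ρ u S)
    (hfar : ∀ x : E3, R ≤ ‖x‖ → ρ 0 x = ρbar ∧ u 0 x = 0 ∧ S 0 x = Sbar) (r : ℝ) :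
    ∫ x in closedBall (0 : E3) r, ρ 0 x ≤ (volume : Measure E3).real (closedBall (0 : E3) r) *
      ⨆ x, ρ 0 x := by
  have hρ0 : Continuous (ρ 0) :=
    (contDiff_slice_of_contDiffOn h.contDiffOn_density (mem_Ici.2 le_rfl)).continuous
  have hbdd := bddAbove_range_density_zero h hfar
  have hμBtop : (volume : Measure E3) (closedBall (0 : E3) r) ≠ ⊤ := measure_closedBall_lt_top.ne
  calc ∫ x in closedBall (0 : E3) r, ρ 0 x ≤ ∫ _ in closedBall (0 : E3) r, ⨆ y, ρ 0 y :=
        setIntegral_mono_on (hρ0.continuousOn.integrableOn_compact (isCompact_closedBall _ _))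
          (integrableOn_const hμBtop) measurableSet_closedBall fun x _ => le_ciSup hbdd x
    _ = (volume : Measure E3).real (closedBall (0 : E3) r) * ⨆ x, ρ 0 x := by
        rw [setIntegral_const, smul_eq_mul]

/-! ### (2.2b) the radial momentum against the kinetic energy -/

/-- AM–GM for the integrand of `F`: for `λ > 0`, `ρ ≥ 0` and `‖x‖ ≤ r`,
`2λ |ρ ⟪x, v⟫| ≤ λ² r² ρ + ρ ‖v‖²`. [folklore] -/
theorem two_mul_abs_mul_inner_le {ρ' r l : ℝ} {x v : E3} (hρ : 0 ≤ ρ') (hl : 0 < l)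
    (hx : ‖x‖ ≤ r) : 2 * l * |ρ' * ⟪x, v⟫| ≤ l ^ 2 * (r ^ 2 * ρ') + ρ' * ‖v‖ ^ 2 := by
  have h1 : |⟪x, v⟫| ≤ r * ‖v‖ := (abs_real_inner_le_norm x v).trans (by gcongr)
  rw [abs_mul, abs_of_nonneg hρ]
  have h2 : 2 * l * ρ' * |⟪x, v⟫| ≤ 2 * l * ρ' * (r * ‖v‖) :=
    mul_le_mul_of_nonneg_left h1 (by positivity)
  have h3 : 2 * l * (r * ‖v‖) ≤ l ^ 2 * r ^ 2 + ‖v‖ ^ 2 := by nlinarith [sq_nonneg (l * r - ‖v‖)]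
  have h4 := mul_le_mul_of_nonneg_left h3 hρ
  nlinarith

/-- From the family of AM–GM bounds to the product bound: if `2λ|F| ≤ λ²a + b` for all `λ > 0`
with `a, b ≥ 0`, then `F² ≤ a b`. [folklore] -/
theorem sq_le_mul_of_forall_amgm {F a b : ℝ} (ha : 0 ≤ a) (hb : 0 ≤ b)
    (h : ∀ l : ℝ, 0 < l → 2 * l * |F| ≤ l ^ 2 * a + b) : F ^ 2 ≤ a * b := by
  by_cases hF : F = 0
  · subst hF
    simpa using mul_nonneg ha hb
  have hFpos : 0 < |F| := abs_pos.2 hF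
  rcases ha.lt_or_eq with ha0 | ha0
  · have h1 := h (|F| / a) (div_pos hFpos ha0)
    have h2 : (|F| / a) ^ 2 * a = |F| ^ 2 / a := by field_simp
    rw [h2] at h1
    have h3 : 2 * (|F| / a) * |F| = 2 * (|F| ^ 2 / a) := by ring
    rw [h3] at h1
    have h4 : |F| ^ 2 / a ≤ b := by linarith
    rw [div_le_iff₀ ha0] at h4
    calc F ^ 2 = |F| ^ 2 := (sq_abs F).symm
      _ ≤ b * a := h4
      _ = a * b := mul_comm _ _
  · subst ha0
    have h1 := h ((b + 1) / (2 * |F|)) (div_pos (by linarith) (mul_pos two_pos hFpos))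
    have h2 : 2 * ((b + 1) / (2 * |F|)) * |F| = b + 1 := by field_simp
    rw [h2] at h1
    linarith [sq_nonneg ((b + 1) / (2 * |F|))]

/-- **(2.2b)** `F(t)² ≤ ((R + σt)² ∫_{B(t)} ρ) · ∫ ρ ‖u‖²` for `t ≥ 0` (printed: Schwarz's
inequality `(∫ x·ρu)² ≤ (∫_B |x|²ρ)(∫_B ρ|u|²)` and `|x| ≤ R + σt` on `B(t)`; here via the AM–GM
family `two_mul_abs_mul_inner_le` integrated over `ℝ³`, where `u = 0` off `B(t)`). [cite: Sideris1985, §2 (2.2b)] -/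
theorem sq_radialMomentum_le (h : IsPolytropicC1Solution A γ (Ici 0) ρ u S) (hσ : 0 ≤ σ)
    (hrest : ∀ t, 0 ≤ t → ∀ x : E3, R + σ * t ≤ ‖x‖ → ρ t x = ρbar ∧ u t x = 0 ∧ S t x = Sbar)
    {t : ℝ} (ht : 0 ≤ t) :
    radialMomentum ρ u t ^ 2 ≤
      ((R + σ * t) ^ 2 * ∫ x in closedBall (0 : E3) (R + σ * t), ρ t x) *
        ∫ x, ρ t x * ‖u t x‖ ^ 2 := by
  have ht' : t ∈ Ici (0 : ℝ) := ht
  set r := R + σ * t with hr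
  set B : Set E3 := closedBall (0 : E3) r with hB
  have hBc : IsCompact B := isCompact_closedBall _ _
  have hrestB : ∀ x ∉ B, ρ t x = ρbar ∧ u t x = 0 ∧ S t x = Sbar := fun x hx =>
    rest_of_notMem_closedBall (T := t) hσ hrest ht le_rfl hx
  have hρs : ContDiff ℝ 1 (ρ t) := contDiff_slice_of_contDiffOn h.contDiffOn_density ht'
  have hus : ContDiff ℝ 1 (u t) := contDiff_slice_of_contDiffOn h.contDiffOn_velocity ht'
  have hρnn : ∀ x, 0 ≤ ρ t x := fun x => (h.density_pos t ht x).le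
  -- the two integrals `a = r² ∫_B ρ`, `b = ∫ ρ ‖u‖²`
  have hIB : ∫ x in B, ρ t x = ∫ x, B.indicator (ρ t) x := (integral_indicator measurableSet_closedBall).symm
  have hind_int : Integrable (B.indicator (ρ t)) :=
    (hρs.continuous.continuousOn.integrableOn_compact hBc).integrable_indicator
      measurableSet_closedBall
  have hb_int : Integrable fun x => ρ t x * ‖u t x‖ ^ 2 :=
    (hρs.continuous.mul (hus.continuous.norm.pow 2)).integrable_of_hasCompactSupport
      (HasCompactSupport.intro hBc fun x hx => by simp [(hrestB x hx).2.1])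
  have hF_int : Integrable fun x => ρ t x * ⟪x, u t x⟫ :=
    (hρs.continuous.mul (continuous_id.inner hus.continuous)).integrable_of_hasCompactSupport
      (HasCompactSupport.intro hBc fun x hx => by simp [(hrestB x hx).2.1])
  have ha0 : 0 ≤ r ^ 2 * ∫ x in B, ρ t x :=
    mul_nonneg (sq_nonneg _) (setIntegral_nonneg measurableSet_closedBall fun x _ => hρnn x)
  have hb0 : 0 ≤ ∫ x, ρ t x * ‖u t x‖ ^ 2 :=
    integral_nonneg fun x => mul_nonneg (hρnn x) (sq_nonneg _)
  refine sq_le_mul_of_forall_amgm ha0 hb0 fun l hl => ?_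
  -- pointwise AM–GM, then integrate
  have hpt : ∀ x, 2 * l * |ρ t x * ⟪x, u t x⟫| ≤
      l ^ 2 * (r ^ 2 * B.indicator (ρ t) x) + ρ t x * ‖u t x‖ ^ 2 := by
    intro x
    by_cases hx : x ∈ B
    · rw [indicator_of_mem hx]
      exact two_mul_abs_mul_inner_le (hρnn x) hl (by simpa [hB, hr] using hx)
    · simp [indicator_of_notMem hx, (hrestB x hx).2.1]
  calc 2 * l * |radialMomentum ρ u t| ≤ 2 * l * ∫ x, |ρ t x * ⟪x, u t x⟫| := by
        have := abs_integral_le_integral_abs (f := fun x => ρ t x * ⟪x, u t x⟫) (μ := volume)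
        exact mul_le_mul_of_nonneg_left this (by positivity)
    _ = ∫ x, 2 * l * |ρ t x * ⟪x, u t x⟫| := (integral_const_mul _ _).symm
    _ ≤ ∫ x, (l ^ 2 * (r ^ 2 * B.indicator (ρ t) x) + ρ t x * ‖u t x‖ ^ 2) :=
        integral_mono (hF_int.abs.const_mul _)
          (((hind_int.const_mul _).const_mul _).add hb_int) hpt
    _ = l ^ 2 * (r ^ 2 * ∫ x in B, ρ t x) + ∫ x, ρ t x * ‖u t x‖ ^ 2 := by
        rw [integral_add ((hind_int.const_mul _).const_mul _) hb_int, integral_const_mul,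
          integral_const_mul, hIB]

end Estimates

end Literature.Barriers.AtomisticToContinuum.PolytropicEuler

end
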